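import Mathlib
import Summits.NavierStokesRegularity.NavierStokesRegularity.Theorems.TaoLadderRungTwoBreakOneShiftWindowReduction
import HarnessLib

/-!
# Kernel STAGE 3, frame rows: for a GEOMETRIC frame the infinite row families of the end-to-end theorem
# follow from finitely many inequalities (cell harvest/h2-tao-ladder, seat p2; rung1/KERNEL-STAGE3-PLAN.md brick (7);
# support for K1(1) = `NoSurvivingDSSOne`, stmt-NavierStokesRegularity-20205)

MODEL lattice ODEs only; nothing about the Navier–Stokes equations; no item closed; CONDITIONAL glue.

The end-to-end theorems (`…_v3`/`…_v4`) take four REAL-NUMBER FAMILIES indexed by the tail shells as hypotheses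
(contraction rows, self-map rows, rate rows, centre mismatch). On p2's frames (STAGE2/3: wake weights
`ω θ^{|k|}`, amplitudes under `abar β^{|k|}`, rates under `rbar σ^{|k|}`; top weights `ω_t ϑ^{k-W}`, amplitudes
`abar_t ϑ_A^{k-W}`) every term of a row is GEOMETRIC in the shell index with a ratio not exceeding the weight's, so
each family holds for all shells as soon as it holds at the first interior shell (`k = -2` on the wake side,
`k = W+1` on the top side; the boundary shells `k = -1`, `k = W`, which read window shells, stay explicit).
* `shiftSet_index_bounds` — the indices read by `quadTerm` at shell `k` lie in `[k-1, k+1]`, the gain exponent in `[k-1, k]`;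
* `tableAbsSum` — `Σ_{i₁,i₂,μ∈S} |α_{i₁i₂iμ}|`;
* `quadTermLip_wake_le` / `quadTermLip_top_le` — geometric envelopes of the Lipschitz functional on the wake
  (`k ≤ -2`) and on the top (`k ≥ W+1`);
* `wake_rows_of_first` / `top_rows_of_first` — the contraction rows for all interior tail shells from the row
  at the first interior shell.
-/

noncomputable section

-- `Summit.NavierStokesRegularity.NavierStokesRegularity.…` is the tree's (summit = problem) namespace; the
-- duplicated component is intended, so the dupNamespace linter is silenced for this file.
set_option linter.dupNamespace false

namespace Summit.NavierStokesRegularity.NavierStokesRegularity.Theorems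

namespace DSSOneShift

open Set MeasureTheory intervalIntegral
open Literature.Analysis.FluidPDE Literature.Analysis.FluidPDE.TaoCascade CertificateGlueOn

variable {m : ℕ}

namespace OneShiftFrame

variable (F : OneShiftFrame m)

/-- The shells read by the quadratic field at shell `k` through the shift `μ ∈ S` lie in `[k-1, k+1]` and the
gain exponent `k - μ₃` in `[k-1, k]`. [cite: Tao2016AveragedNS, §4 after (4.1) (the shift set S); cell vocabulary] -/
theorem shiftSet_index_bounds {μ : ℤ × ℤ × ℤ} (hμ : μ ∈ shiftSet) (k : ℤ) :
    (k - 1 ≤ k - μ.2.2 + μ.1 ∧ k - μ.2.2 + μ.1 ≤ k + 1) ∧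
      (k - 1 ≤ k - μ.2.2 + μ.2.1 ∧ k - μ.2.2 + μ.2.1 ≤ k + 1) ∧ (k - 1 ≤ k - μ.2.2 ∧ k - μ.2.2 ≤ k) := by
  rcases (mem_shiftSet_iff μ).1 hμ with rfl | rfl | rfl | rfl <;> simp <;> omega

/-- `Σ_{i₁,i₂,μ∈S} |α_{i₁i₂iμ}|` — the table's absolute row sum feeding mode `i`.
[cite: Tao2016AveragedNS, §4 (4.1); cell vocabulary] -/
def tableAbsSum (α : Fin m → Fin m → Fin m → ℤ × ℤ × ℤ → ℝ) (i : Fin m) : ℝ :=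
  ∑ i₁ : Fin m, ∑ i₂ : Fin m, ∑ μ ∈ shiftSet, |α i₁ i₂ i μ|

/-- **Geometric envelope of the Lipschitz functional on the WAKE.** At the wake shell `k = -(n+2)` (so the
three shells read, `-(n+3) … -(n+1)`, are tail shells): with `D_{-(j+1)} ≤ ω θ^{j+1}`, `0 ≤ A_{-j} ≤ abar β^{j}`
(`θ, β ≥ 1`, `Λ ≥ 1`), `quadTermLip(A,D)(i,k) ≤ 2 (Σ|α|) (Λ⁻¹)^{n+2} (ω θ^{n+3}) (abar β^{n+3})`.
[cite: Tao2016AveragedNS, §4 (4.8); cell vocabulary, harvest/h2-tao-ladder rung1/STAGE3-BANACH.md §2 (Lip(−j ← −j′))] -/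
theorem quadTermLip_wake_le {ε₀ ω θ abar β : ℝ} (hε : 0 < 1 + ε₀) (hΛ1 : 1 ≤ bigLam ε₀) (hθ : 1 ≤ θ)
    (hβ : 1 ≤ β) (hω : 0 ≤ ω) (habar : 0 ≤ abar) (α : Fin m → Fin m → Fin m → ℤ × ℤ × ℤ → ℝ) {A D : ℤ → ℝ}
    (hAnn : ∀ k', 0 ≤ A k') (hDnn : ∀ k', 0 ≤ D k')
    (hD : ∀ j : ℕ, D (-(j : ℤ) - 1) ≤ ω * θ ^ (j + 1)) (hA : ∀ j : ℕ, A (-(j : ℤ)) ≤ abar * β ^ j)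
    (i : Fin m) (n : ℕ) :
    quadTermLip ε₀ α A D i (-(n : ℤ) - 2) ≤
      2 * tableAbsSum α i * (bigLam ε₀)⁻¹ ^ (n + 2) * (ω * θ ^ (n + 3)) * (abar * β ^ (n + 3)) := by
  have hΛpos : 0 < bigLam ε₀ := bigLam_pos (by linarith)
  set k : ℤ := -(n : ℤ) - 2 with hk
  set X := ω * θ ^ (n + 3) with hX
  set Y := abar * β ^ (n + 3) with hY
  have hX0 : 0 ≤ X := mul_nonneg hω (pow_nonneg (by linarith) _)
  have hY0 : 0 ≤ Y := mul_nonneg habar (pow_nonneg (by linarith) _)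
  -- envelopes at the shells read
  have hDa : ∀ a : ℤ, k - 1 ≤ a → a ≤ k + 1 → D a ≤ X := by
    intro a ha1 ha2
    obtain ⟨j, hj⟩ : ∃ j : ℕ, a = -(j : ℤ) - 1 := ⟨(-a - 1).toNat, by omega⟩
    rw [hj]
    refine (hD j).trans (mul_le_mul_of_nonneg_left (pow_le_pow_right₀ hθ (by omega)) hω)
  have hAb : ∀ b : ℤ, k - 1 ≤ b → b ≤ k + 1 → A b ≤ Y := by
    intro b hb1 hb2
    obtain ⟨j, hj⟩ : ∃ j : ℕ, b = -(j : ℤ) := ⟨(-b).toNat, by omega⟩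
    rw [hj]
    refine (hA j).trans (mul_le_mul_of_nonneg_left (pow_le_pow_right₀ hβ (by omega)) habar)
  have hgainK : (bigLam ε₀) ^ k = (bigLam ε₀)⁻¹ ^ (n + 2) := by
    rw [hk, show (-(n : ℤ) - 2) = -(((n + 2 : ℕ) : ℤ)) by push_cast; ring, zpow_neg, zpow_natCast, inv_pow]
  have h1 : quadTermLip ε₀ α A D i k ≤
      ∑ i₁ : Fin m, ∑ i₂ : Fin m, ∑ μ ∈ shiftSet, |α i₁ i₂ i μ| * ((bigLam ε₀) ^ k * (X * Y + Y * X)) := by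
    unfold quadTermLip
    refine Finset.sum_le_sum fun i₁ _ => Finset.sum_le_sum fun i₂ _ => Finset.sum_le_sum fun μ hμ => ?_
    obtain ⟨⟨ha1, ha2⟩, ⟨hb1, hb2⟩, ⟨_, hg2⟩⟩ := shiftSet_index_bounds hμ k
    have hgain : (1 + ε₀) ^ ((5 : ℝ) * (k - μ.2.2) / 2) ≤ (bigLam ε₀) ^ k := by
      have e := bigLam_zpow_eq_rpow hε (k - μ.2.2)
      push_cast at e
      rw [e]
      exact zpow_le_zpow_right₀ hΛ1 hg2
    have hprod : D (k - μ.2.2 + μ.1) * A (k - μ.2.2 + μ.2.1) + A (k - μ.2.2 + μ.1) * D (k - μ.2.2 + μ.2.1) ≤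
        X * Y + Y * X :=
      add_le_add (mul_le_mul (hDa _ ha1 ha2) (hAb _ hb1 hb2) (hAnn _) hX0)
        (mul_le_mul (hAb _ ha1 ha2) (hDa _ hb1 hb2) (hDnn _) hY0)
    have hα0 : 0 ≤ |α i₁ i₂ i μ| := abs_nonneg _
    have hpn : 0 ≤ D (k - μ.2.2 + μ.1) * A (k - μ.2.2 + μ.2.1) + A (k - μ.2.2 + μ.1) * D (k - μ.2.2 + μ.2.1) :=
      add_nonneg (mul_nonneg (hDnn _) (hAnn _)) (mul_nonneg (hAnn _) (hDnn _))
    rw [mul_assoc]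
    refine mul_le_mul_of_nonneg_left ?_ hα0
    exact mul_le_mul hgain hprod hpn (zpow_nonneg hΛpos.le _)
  calc quadTermLip ε₀ α A D i k
      ≤ ∑ i₁ : Fin m, ∑ i₂ : Fin m, ∑ μ ∈ shiftSet, |α i₁ i₂ i μ| * ((bigLam ε₀) ^ k * (X * Y + Y * X)) := h1
    _ = tableAbsSum α i * ((bigLam ε₀) ^ k * (X * Y + Y * X)) := by
        unfold tableAbsSum; simp only [Finset.sum_mul]
    _ = 2 * tableAbsSum α i * (bigLam ε₀)⁻¹ ^ (n + 2) * X * Y := by rw [hgainK]; ring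

/-- **WAKE ROWS FROM THE FIRST INTERIOR ROW.** On a geometric wake frame (weights `wt_{-(j+1)} = ω θ^{j+1}`,
amplitudes `A_{-j} ≤ abar β^j`, rates `R_{-(j+1)} ≤ rbar σ^{j+1}`, distance coefficients `D_{-(j+1)} ≤ ω θ^{j+1}`,
with `1 ≤ β ≤ θ`, `β ≤ Λ`, `0 ≤ σ ≤ θ`) every term of the contraction row at `k = -(n+2)` is at most `θⁿ` times
its value at `k = -2`; hence the row inequality at `k = -2` (a single number) gives it at every `k ≤ -2`.
[cite: Tao2016AveragedNS, §4 (4.8); cell vocabulary, harvest/h2-tao-ladder rung1/STAGE3-BANACH.md §2 (θ_w attained at j = 1)] -/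
theorem wake_rows_of_first {ε₀ ω θ abar β rbar σ gHi γ q : ℝ} (hε : 0 < 1 + ε₀) (hΛ1 : 1 ≤ bigLam ε₀)
    (hθ : 1 ≤ θ) (hβ : 1 ≤ β) (hβθ : β ≤ θ) (hβΛ : β ≤ bigLam ε₀) (hσ : 0 ≤ σ) (hσθ : σ ≤ θ)
    (hω : 0 ≤ ω) (habar : 0 ≤ abar) (hrbar : 0 ≤ rbar) (hgHi : 0 ≤ gHi) (hγ : 0 ≤ γ)
    (α : Fin m → Fin m → Fin m → ℤ × ℤ × ℤ → ℝ) {A D R : ℤ → ℝ}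
    (hAnn : ∀ k', 0 ≤ A k') (hDnn : ∀ k', 0 ≤ D k')
    (hD : ∀ j : ℕ, D (-(j : ℤ) - 1) ≤ ω * θ ^ (j + 1)) (hA : ∀ j : ℕ, A (-(j : ℤ)) ≤ abar * β ^ j)
    (hR : ∀ j : ℕ, R (-(j : ℤ) - 1) ≤ rbar * σ ^ (j + 1)) (hwt : ∀ j : ℕ, F.wt (-(j : ℤ) - 1) = ω * θ ^ (j + 1))
    (hfirst : ∀ i, gHi * (ω * θ + rbar * σ * F.rτ) + abar * β * γ +
      F.τhi * (2 * tableAbsSum α i * (bigLam ε₀)⁻¹ ^ 2 * (ω * θ ^ 3) * (abar * β ^ 3)) ≤ q * (ω * θ ^ 2))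
    (i : Fin m) (n : ℕ) :
    gHi * (F.wt (-(n : ℤ) - 2 + 1) + R (-(n : ℤ) - 2 + 1) * F.rτ) + A (-(n : ℤ) - 2 + 1) * γ +
        F.τhi * quadTermLip ε₀ α A D i (-(n : ℤ) - 2) ≤ q * F.wt (-(n : ℤ) - 2) := by
  have hΛpos : 0 < bigLam ε₀ := bigLam_pos (by linarith)
  have hθ0 : 0 ≤ θ := by linarith
  have hrτ := F.rτ_pos.le
  have hτ := F.τhi_pos.le
  have e1 : (-(n : ℤ) - 2 + 1) = -(n : ℤ) - 1 := by ring
  have e2 : (-(n : ℤ) - 2) = -((n + 1 : ℕ) : ℤ) - 1 := by push_cast; ring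
  rw [e1, hwt n]
  rw [show F.wt (-(n : ℤ) - 2) = ω * θ ^ (n + 2) by rw [e2, hwt (n + 1)]]
  have hT2 : R (-(n : ℤ) - 1) * F.rτ ≤ rbar * σ * F.rτ * θ ^ n := by
    have h := hR n
    have hσn : σ ^ n ≤ θ ^ n := pow_le_pow_left₀ hσ hσθ n
    calc R (-(n : ℤ) - 1) * F.rτ ≤ rbar * σ ^ (n + 1) * F.rτ := mul_le_mul_of_nonneg_right h hrτ
      _ = rbar * σ * F.rτ * σ ^ n := by ring
      _ ≤ rbar * σ * F.rτ * θ ^ n := mul_le_mul_of_nonneg_left hσn (by positivity)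
  have hT3 : A (-(n : ℤ) - 1) * γ ≤ abar * β * γ * θ ^ n := by
    have h := hA (n + 1)
    have e : (-((n + 1 : ℕ) : ℤ)) = -(n : ℤ) - 1 := by push_cast; ring
    rw [e] at h
    have hβn : β ^ n ≤ θ ^ n := pow_le_pow_left₀ (by linarith) hβθ n
    calc A (-(n : ℤ) - 1) * γ ≤ abar * β ^ (n + 1) * γ := mul_le_mul_of_nonneg_right h hγ
      _ = abar * β * γ * β ^ n := by ring
      _ ≤ abar * β * γ * θ ^ n := mul_le_mul_of_nonneg_left hβn (by positivity)
  have hT4 : quadTermLip ε₀ α A D i (-(n : ℤ) - 2) ≤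
      2 * tableAbsSum α i * (bigLam ε₀)⁻¹ ^ 2 * (ω * θ ^ 3) * (abar * β ^ 3) * θ ^ n := by
    refine (quadTermLip_wake_le hε hΛ1 hθ hβ hω habar α hAnn hDnn hD hA i n).trans ?_
    -- `(Λ⁻¹)^{n+2} θ^{n+3} β^{n+3} = (Λ⁻¹)² θ³ β³ · (θ β/Λ)ⁿ ≤ (Λ⁻¹)² θ³ β³ · θⁿ`
    have hS0 : 0 ≤ tableAbsSum α i := by
      unfold tableAbsSum
      exact Finset.sum_nonneg fun _ _ => Finset.sum_nonneg fun _ _ => Finset.sum_nonneg fun _ _ => abs_nonneg _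
    have hratio : (β * (bigLam ε₀)⁻¹) ^ n ≤ 1 := by
      refine pow_le_one₀ (by positivity) ?_
      rw [mul_inv_le_iff₀ hΛpos, one_mul]; exact hβΛ
    have hkey : (bigLam ε₀)⁻¹ ^ (n + 2) * θ ^ (n + 3) * β ^ (n + 3) ≤ (bigLam ε₀)⁻¹ ^ 2 * θ ^ 3 * β ^ 3 * θ ^ n := by
      have hid : (bigLam ε₀)⁻¹ ^ (n + 2) * θ ^ (n + 3) * β ^ (n + 3) =
          (bigLam ε₀)⁻¹ ^ 2 * θ ^ 3 * β ^ 3 * θ ^ n * (β * (bigLam ε₀)⁻¹) ^ n := by ring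
      rw [hid]
      have hpos : 0 ≤ (bigLam ε₀)⁻¹ ^ 2 * θ ^ 3 * β ^ 3 * θ ^ n := by positivity
      calc (bigLam ε₀)⁻¹ ^ 2 * θ ^ 3 * β ^ 3 * θ ^ n * (β * (bigLam ε₀)⁻¹) ^ n
          ≤ (bigLam ε₀)⁻¹ ^ 2 * θ ^ 3 * β ^ 3 * θ ^ n * 1 := mul_le_mul_of_nonneg_left hratio hpos
        _ = _ := by ring
    calc 2 * tableAbsSum α i * (bigLam ε₀)⁻¹ ^ (n + 2) * (ω * θ ^ (n + 3)) * (abar * β ^ (n + 3))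
        = 2 * tableAbsSum α i * ω * abar * ((bigLam ε₀)⁻¹ ^ (n + 2) * θ ^ (n + 3) * β ^ (n + 3)) := by ring
      _ ≤ 2 * tableAbsSum α i * ω * abar * ((bigLam ε₀)⁻¹ ^ 2 * θ ^ 3 * β ^ 3 * θ ^ n) :=
          mul_le_mul_of_nonneg_left hkey (by positivity)
      _ = _ := by ring
  have hsum := hfirst i
  have hθn : 0 ≤ θ ^ n := pow_nonneg hθ0 n
  calc gHi * (ω * θ ^ (n + 1) + R (-(n : ℤ) - 1) * F.rτ) + A (-(n : ℤ) - 1) * γ +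
        F.τhi * quadTermLip ε₀ α A D i (-(n : ℤ) - 2)
      ≤ gHi * (ω * θ * θ ^ n + rbar * σ * F.rτ * θ ^ n) + abar * β * γ * θ ^ n +
          F.τhi * (2 * tableAbsSum α i * (bigLam ε₀)⁻¹ ^ 2 * (ω * θ ^ 3) * (abar * β ^ 3) * θ ^ n) := by
        have e : ω * θ ^ (n + 1) = ω * θ * θ ^ n := by ring
        rw [e]
        gcongr
    _ = (gHi * (ω * θ + rbar * σ * F.rτ) + abar * β * γ +
          F.τhi * (2 * tableAbsSum α i * (bigLam ε₀)⁻¹ ^ 2 * (ω * θ ^ 3) * (abar * β ^ 3))) * θ ^ n := by ring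
    _ ≤ q * (ω * θ ^ 2) * θ ^ n := mul_le_mul_of_nonneg_right hsum hθn
    _ = q * (ω * θ ^ (n + 2)) := by ring

end OneShiftFrame

end DSSOneShift

end Summit.NavierStokesRegularity.NavierStokesRegularity.Theorems
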